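import Literature.Topology.FourManifolds.MMSWRasmussenFacts
import Literature.Topology.FourManifolds.CircleLoopNullhomotopy
import Summits.SmoothPoincare4.SmoothPoincare4.Theses.DottedCircleRasmussen
import Summits.SmoothPoincare4.SmoothPoincare4.Theorems.DottedCircleRasmussenDcrGapHelperFriendsCarrierInversion

/-!
# Helper `helper_friendsCarrier_Vk_homotopyClause` (piece 3 of the registered helper `helper_friendsCarrier_Vk`,
stub `stub_friendsCarrier`, line `mk_friends`, skeleton v5) for crux `DcrGap`
(item stmt-SmoothPoincare4-16128, route route-SmoothPoincare4-DottedCircleRasmussen)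

**The homotopy clause of V_k through the chart at infinity.**  The last clause of the registered helper
`helper_friendsCarrier_Vk` compares two loops of the INVERTED model disc exterior
`F = E^ = {0} ∪ {y ≠ 0 | y/‖y‖² ∉ D_k ∪ Δ₁}`: the pushed dual knot `L₁ = c(μ₁(·), 0)` of the collar and
the inverted tube meridian `L₂(v) = T(0, v/2)/‖T(0, v/2)‖²`, in the form
"`g ∘ L₁` null-homotopic ⇒ `g ∘ L₂` null-homotopic" for every continuous `g : F → Z`.  This file
reduces that clause to a statement about the UNINVERTED exterior `E = ℝ⁴ ∖ (D_k ∪ Δ₁)`: it suffices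
that `L₁` be the inversion of a loop `L₁'` of `E` with **Kervaire's property** — every map of `E`
killing `L₁'` kills every based loop of `E` — which is exactly the conclusion of the landed Kervaire
lemma `helper_friendsPi1_G2` for the tube meridian of ANY trivialised tube of ANY model slice disc with
exterior `E` (so the collar only has to push the dual knot onto such a meridian, as the `k = 0`
template `SliceDiscEndCollar.lean` does with its flat formula `c(jB(p, v), σ) = G(4p, r(σ) v)`).
The proof is bookkeeping: `g ∘ ι` (`ι : E → F` the inversion, continuous since `0 ∈ D_k`) kills
`L₁'`, hence kills the based loop of the meridian `μ'(v) = T(0, v/2)` of `E` (a point of `E`: off `D_k`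
by the tube clause, off `Δ₁` by injectivity of the tube and `K₁ ⊂ M_k ⊂ D_k`), hence `g ∘ ι ∘ μ'`
is freely null-homotopic (tree: `ContinuousMap.homotopic_const_of_circleLoop_homotopic_refl`), and
`g ∘ L₂ = g ∘ ι ∘ μ'`.

No definitions, no named facts, no `sorry`.

## References

* M. Kervaire, *Les nœuds de dimensions supérieures*, Bull. SMF 93 (1965), Ch. I Lemme 1.2. [KervaireBSMF1965]
* A. Hatcher, *Algebraic Topology* (2002), §1.1 (free vs based null-homotopy of loops). [HatcherAT2002]
-/

-- the prescribed namespace `Summit.<P>.<Sub>.…` duplicates `SmoothPoincare4` (P = Sub)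
set_option linter.dupNamespace false
set_option linter.style.longLine false

noncomputable section

open scoped Manifold ContDiff Topology
open Function Set Metric
open Literature.Topology.FourManifolds Literature.Topology.FourManifolds.MMSW

namespace Summit.SmoothPoincare4.SmoothPoincare4.Theorems.DcrGap.MkFriends

namespace FriendsCarrierVk

/-- **The tube meridian lies in the disc exterior.**  For a model slice disc `f₁` of a model knot `K₁`
with a trivialised tube `T` (injective on `D̊² × B(0,2)`, off `D_k`, `T(x, 0) = f₁ x`), the point
`T(0, v/2)` (`v ∈ S¹`) is off `D_k` and off `Δ₁ = f₁(𝔻²)`. [folklore] -/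
theorem tubeMeridian_mem_exterior {k : ℕ} {K₁ : (Metric.sphere (0 : EuclideanSpace ℝ (Fin 2)) 1) → EuclideanSpace ℝ (Fin 4)}
    {f₁ : EuclideanSpace ℝ (Fin 2) → EuclideanSpace ℝ (Fin 4)}
    {T : EuclideanSpace ℝ (Fin 2) × EuclideanSpace ℝ (Fin 2) → EuclideanSpace ℝ (Fin 4)}
    (hK : IsModelKnot k K₁) (hf : IsModelSliceDisc k K₁ f₁)
    (hTi : InjOn T (ball (0 : EuclideanSpace ℝ (Fin 2)) 1 ×ˢ ball (0 : EuclideanSpace ℝ (Fin 2)) 2))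
    (hTD : ∀ q ∈ ball (0 : EuclideanSpace ℝ (Fin 2)) 1 ×ˢ ball (0 : EuclideanSpace ℝ (Fin 2)) 2, T q ∉ modelHandlebody k)
    (hT0 : ∀ x ∈ ball (0 : EuclideanSpace ℝ (Fin 2)) 1, T (x, 0) = f₁ x)
    (v : Metric.sphere (0 : EuclideanSpace ℝ (Fin 2)) 1) :
    T ((0 : EuclideanSpace ℝ (Fin 2)), (1 / 2 : ℝ) • (v : EuclideanSpace ℝ (Fin 2))) ∉ modelHandlebody k ∧
      T ((0 : EuclideanSpace ℝ (Fin 2)), (1 / 2 : ℝ) • (v : EuclideanSpace ℝ (Fin 2))) ∉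
        f₁ '' closedBall (0 : EuclideanSpace ℝ (Fin 2)) 1 := by
  have hv : ‖(1 / 2 : ℝ) • (v : EuclideanSpace ℝ (Fin 2))‖ = 1 / 2 := by
    rw [norm_smul, norm_eq_of_mem_sphere, mul_one, Real.norm_eq_abs, abs_of_pos (by norm_num)]
  have hq : ((0 : EuclideanSpace ℝ (Fin 2)), (1 / 2 : ℝ) • (v : EuclideanSpace ℝ (Fin 2))) ∈
      ball (0 : EuclideanSpace ℝ (Fin 2)) 1 ×ˢ ball (0 : EuclideanSpace ℝ (Fin 2)) 2 := by
    refine ⟨by simp, ?_⟩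
    rw [mem_ball_zero_iff, hv]; norm_num
  refine ⟨hTD _ hq, ?_⟩
  rintro ⟨x, hx, hxe⟩
  rw [mem_closedBall_zero_iff] at hx
  rcases hx.lt_or_eq with hlt | heq
  · -- interior point: injectivity of the tube
    have hx' : ((x, (0 : EuclideanSpace ℝ (Fin 2))) : EuclideanSpace ℝ (Fin 2) × EuclideanSpace ℝ (Fin 2)) ∈
        ball (0 : EuclideanSpace ℝ (Fin 2)) 1 ×ˢ ball (0 : EuclideanSpace ℝ (Fin 2)) 2 :=
      ⟨mem_ball_zero_iff.2 hlt, by simp⟩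
    have h := hTi hx' hq (by rw [hT0 x (mem_ball_zero_iff.2 hlt), hxe])
    have h2 := congrArg Prod.snd h
    simp only at h2
    have : (1 / 2 : ℝ) • (v : EuclideanSpace ℝ (Fin 2)) ≠ 0 :=
      smul_ne_zero (by norm_num) (ne_zero_of_mem_unit_sphere v)
    exact this h2.symm
  · -- boundary point: `f₁ x = K₁ x ∈ M_k ⊂ D_k`
    have hxs : x ∈ Metric.sphere (0 : EuclideanSpace ℝ (Fin 2)) 1 := mem_sphere_zero_iff_norm.2 heq
    have hfx : f₁ x = K₁ ⟨x, hxs⟩ := hf.apply_sphere ⟨x, hxs⟩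
    have hmem : f₁ x ∈ modelHandlebody k := by
      rw [hfx]; exact modelBoundary_subset_modelHandlebody (hK.mem _)
    exact hTD _ hq (hxe ▸ hmem)

end FriendsCarrierVk

open FriendsCarrierVk in
/-- **Helper `helper_friendsCarrier_Vk_homotopyClause`** (registered piece of `helper_friendsCarrier_Vk`: its
homotopy clause through the chart at infinity).  Let `f₁` be a model slice disc of the model knot `K₁`
with trivialised tube `T`, `E = ℝ⁴ ∖ (D_k ∪ Δ₁)` and `F = E^` the inverted exterior (as `Opens ℝ⁴`, by
their defining equations).  If `L₁'` is a loop of `E` with Kervaire's property (every map of `E`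
killing `L₁'` kills every based loop of `E` — the conclusion of `helper_friendsPi1_G2` for a tube
meridian), then for every loop `L₁` of `F` which is the inversion of `L₁'` and every loop `L₂` of `F`
which is the inverted tube meridian `v ↦ T(0, v/2)/‖T(0, v/2)‖²`, and every continuous `g : F → Z`:
if `g ∘ L₁` is null-homotopic then so is `g ∘ L₂`. [cite: KervaireBSMF1965, Ch. I Lemme 1.2] -/
theorem helper_friendsCarrier_Vk_homotopyClause : ∀ (k : ℕ) (K₁ : (Metric.sphere (0 : EuclideanSpace ℝ (Fin 2)) 1) → EuclideanSpace ℝ (Fin 4)) (f₁ : EuclideanSpace ℝ (Fin 2) → EuclideanSpace ℝ (Fin 4)) (T : EuclideanSpace ℝ (Fin 2) × EuclideanSpace ℝ (Fin 2) → EuclideanSpace ℝ (Fin 4)), Literature.Topology.FourManifolds.MMSW.IsModelKnot k K₁ → Literature.Topology.FourManifolds.MMSW.IsModelSliceDisc k K₁ f₁ → (ContDiffOn ℝ ((⊤ : ℕ∞) : WithTop ℕ∞) T (Metric.ball (0 : EuclideanSpace ℝ (Fin 2)) 1 ×ˢ Metric.ball (0 : EuclideanSpace ℝ (Fin 2)) 2)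 ∧ Set.InjOn T (Metric.ball (0 : EuclideanSpace ℝ (Fin 2)) 1 ×ˢ Metric.ball (0 : EuclideanSpace ℝ (Fin 2)) 2) ∧ (∀ q ∈ Metric.ball (0 : EuclideanSpace ℝ (Fin 2)) 1 ×ˢ Metric.ball (0 : EuclideanSpace ℝ (Fin 2)) 2, Function.Injective (fderiv ℝ T q)) ∧ (∀ q ∈ Metric.ball (0 : EuclideanSpace ℝ (Fin 2)) 1 ×ˢ Metric.ball (0 : EuclideanSpace ℝ (Fin 2)) 2, T q ∉ Literature.Topology.FourManifolds.MMSW.modelHandlebody k) ∧ (∀ x ∈ Metric.ball (0 : EuclideanSpace ℝ (Fin 2)) 1, T (x, 0) = f₁ x)) → ∀ (E F : TopologicalSpace.Opens (EuclideanSpace ℝ (Fin 4))), ((E : Set (EuclideanSpace ℝ (Fin 4))) = {x | x ∉ Literature.Topology.FourManifolds.MMSW.modelHandlebody k ∧ x ∉ f₁ '' Metric.closedBall (0 : EuclideanSpace ℝ (Fin 2)) 1}) → ((F : Set (EuclideanSpace ℝ (Fin 4))) = {0} ∪ {y : EuclideanSpace ℝ (Fin 4) | y ≠ 0 ∧ (‖y‖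 ^ 2)⁻¹ • y ∉ Literature.Topology.FourManifolds.MMSW.modelHandlebody k ∧ (‖y‖ ^ 2)⁻¹ • y ∉ f₁ '' Metric.closedBall (0 : EuclideanSpace ℝ (Fin 2)) 1}) → ∀ (L₁' : C((Metric.sphere (0 : EuclideanSpace ℝ (Fin 2)) 1), E)), (∀ (Z : Type) [TopologicalSpace Z] (ψ : C(E, Z)), (∃ z₀ : Z, (ψ.comp L₁').Homotopic (ContinuousMap.const (Metric.sphere (0 : EuclideanSpace ℝ (Fin 2)) 1) z₀)) → ∀ (a : E) (γ : Path a a), (γ.map ψ.continuous).Homotopic (Path.refl (ψ a))) → ∀ (L₁ L₂ : C((Metric.sphere (0 : EuclideanSpace ℝ (Fin 2)) 1), F)), (∀ v : (Metric.sphere (0 : EuclideanSpace ℝ (Fin 2)) 1), ((L₁ v : F) : EuclideanSpace ℝ (Fin 4)) = (‖((L₁' v : E) : EuclideanSpace ℝ (Fin 4))‖ ^ 2)⁻¹ • ((L₁' v : E) : EuclideanSpace ℝ (Fin 4))) → (∀ v : (Metric.sphere (0 : EuclideanSpace ℝ (Fin 2)) 1), ((L₂ v : F) : EuclideanSpace ℝ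 (Fin 4)) = (‖T ((0 : EuclideanSpace ℝ (Fin 2)), (1 / 2 : ℝ) • (v : EuclideanSpace ℝ (Fin 2)))‖ ^ 2)⁻¹ • T ((0 : EuclideanSpace ℝ (Fin 2)), (1 / 2 : ℝ) • (v : EuclideanSpace ℝ (Fin 2)))) → ∀ (Z : Type) [TopologicalSpace Z] (g : C(F, Z)), (∃ z : Z, (g.comp L₁).Homotopic (ContinuousMap.const (Metric.sphere (0 : EuclideanSpace ℝ (Fin 2)) 1) z)) → ∃ z : Z, (g.comp L₂).Homotopic (ContinuousMap.const (Metric.sphere (0 : EuclideanSpace ℝ (Fin 2)) 1) z) := by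
  intro k K₁ f₁ T hK hf hT E F hE hF L₁' hKer L₁ L₂ hL₁ hL₂ Z _ g hg
  obtain ⟨hTd, hTi, -, hTD, hT0⟩ := hT
  -- membership bookkeeping
  have hmemE : ∀ {x : EuclideanSpace ℝ (Fin 4)}, x ∈ (E : Set (EuclideanSpace ℝ (Fin 4))) ↔
      x ∉ modelHandlebody k ∧ x ∉ f₁ '' closedBall (0 : EuclideanSpace ℝ (Fin 2)) 1 := fun {x} => by
    rw [hE]; rfl
  have hmemF : ∀ {y : EuclideanSpace ℝ (Fin 4)}, y ∈ (F : Set (EuclideanSpace ℝ (Fin 4))) ↔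
      y = 0 ∨ (y ≠ 0 ∧ (‖y‖ ^ 2)⁻¹ • y ∉ modelHandlebody k ∧ (‖y‖ ^ 2)⁻¹ • y ∉ f₁ '' closedBall (0 : EuclideanSpace ℝ (Fin 2)) 1) :=
    fun {y} => by rw [hF]; simp
  have hEne : ∀ a : E, (a : EuclideanSpace ℝ (Fin 4)) ≠ 0 := fun a ha =>
    (hmemE.1 a.2).1 (ha ▸ zero_mem_modelHandlebody k)
  have hιmem : ∀ a : E, (‖(a : EuclideanSpace ℝ (Fin 4))‖ ^ 2)⁻¹ • (a : EuclideanSpace ℝ (Fin 4)) ∈ F := fun a =>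
    hmemF.2 (Or.inr ⟨inv_normSq_smul_ne_zero (hEne a),
      by rw [inv_normSq_smul_inv_normSq_smul (hEne a)]; exact (hmemE.1 a.2).1,
      by rw [inv_normSq_smul_inv_normSq_smul (hEne a)]; exact (hmemE.1 a.2).2⟩)
  -- the inversion `ι : E → F` as a continuous map, and `ψ = g ∘ ι`
  set ι : C(E, F) := ⟨fun a => ⟨(‖(a : EuclideanSpace ℝ (Fin 4))‖ ^ 2)⁻¹ • (a : EuclideanSpace ℝ (Fin 4)), hιmem a⟩, by
    refine Continuous.subtype_mk ?_ _
    exact continuous_iff_continuousAt.2 fun a =>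
      (contDiffAt_inv_normSq_smul (hEne a)).continuousAt.comp continuous_subtype_val.continuousAt⟩ with hι
  set ψ : C(E, Z) := g.comp ι with hψ
  -- `g ∘ L₁ = ψ ∘ L₁'`, so `ψ` kills `L₁'`, hence every based loop of `E`
  have h1 : g.comp L₁ = ψ.comp L₁' := by
    ext v
    show g (L₁ v) = g (ι (L₁' v))
    congr 1
    exact Subtype.ext (hL₁ v)
  rw [h1] at hg
  have hall := hKer Z ψ hg
  -- the tube meridian as a loop of `E`
  have hμmem : ∀ v : Metric.sphere (0 : EuclideanSpace ℝ (Fin 2)) 1,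
      T ((0 : EuclideanSpace ℝ (Fin 2)), (1 / 2 : ℝ) • (v : EuclideanSpace ℝ (Fin 2))) ∈ (E : Set (EuclideanSpace ℝ (Fin 4))) :=
    fun v => hmemE.2 (tubeMeridian_mem_exterior hK hf hTi hTD hT0 v)
  have hμc : Continuous fun v : Metric.sphere (0 : EuclideanSpace ℝ (Fin 2)) 1 =>
      T ((0 : EuclideanSpace ℝ (Fin 2)), (1 / 2 : ℝ) • (v : EuclideanSpace ℝ (Fin 2))) := by
    have hmaps : ∀ v : Metric.sphere (0 : EuclideanSpace ℝ (Fin 2)) 1,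
        ((0 : EuclideanSpace ℝ (Fin 2)), (1 / 2 : ℝ) • (v : EuclideanSpace ℝ (Fin 2))) ∈
          ball (0 : EuclideanSpace ℝ (Fin 2)) 1 ×ˢ ball (0 : EuclideanSpace ℝ (Fin 2)) 2 := fun v => by
      refine ⟨by simp, ?_⟩
      rw [mem_ball_zero_iff, norm_smul, norm_eq_of_mem_sphere, mul_one, Real.norm_eq_abs,
        abs_of_pos (by norm_num)]
      norm_num
    exact hTd.continuousOn.comp_continuous (by fun_prop) hmaps
  set μ' : C((Metric.sphere (0 : EuclideanSpace ℝ (Fin 2)) 1), E) :=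
    ⟨fun v => ⟨T ((0 : EuclideanSpace ℝ (Fin 2)), (1 / 2 : ℝ) • (v : EuclideanSpace ℝ (Fin 2))), hμmem v⟩,
      hμc.subtype_mk _⟩ with hμ'
  -- `ψ` kills the based loop of `μ'`, hence `ψ ∘ μ'` is freely null-homotopic
  have hloop : (ψ.comp μ').circleLoop.Homotopic (Path.refl _) := by
    rw [ContinuousMap.circleLoop_comp]
    exact hall _ μ'.circleLoop
  have hfree := ContinuousMap.homotopic_const_of_circleLoop_homotopic_refl (ψ.comp μ') hloop
  -- `g ∘ L₂ = ψ ∘ μ'`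
  have h2 : g.comp L₂ = ψ.comp μ' := by
    ext v
    show g (L₂ v) = g (ι (μ' v))
    congr 1
    exact Subtype.ext (hL₂ v)
  exact ⟨_, h2 ▸ hfree⟩

end Summit.SmoothPoincare4.SmoothPoincare4.Theorems.DcrGap.MkFriends

end
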